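import Summits.BirchSwinnertonDyer.BirchSwinnertonDyer.Theses.AdditiveKolyvaginRoad
import Summits.BirchSwinnertonDyer.Rank1Residual.X11b.BDPRouteOddPrime
import Summits.BirchSwinnertonDyer.Rank1Residual.X11b.BDPRouteManin
import Summits.BirchSwinnertonDyer.Rank1Residual.X4.KimConjectureIsogenyEdixhoven
import Summits.BirchSwinnertonDyer.Rank1Residual.Additive.GordIsogenyInvarianceClasses
import Literature.NumberTheory.EllipticCurves.NeronIsogenyScalingHoldsProofs
import HarnessLib

/-!
# Route `AdditiveKolyvaginRoad`, support item `ManinFrameOffExceptionClass`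
# (stmt-BirchSwinnertonDyer-20092): Manin-good odd Heegner frames at an additive prime `p ≥ 11`
# for a class off Edixhoven's exception — the Edixhoven twin of `X11b.exists_oddHeegnerData`

Cell `pub/bsd-wall` (D-0120, W-ALL lane 3, row 2), seat `bsd-wall-akr-p2` (prover). THEOREMS ONLY
(no definition, no named fact, no `sorry`); nothing is booked.

WHAT THE ITEM ASKS. From Edixhoven 1991 Thm. 3 in its two tree renderings BY NAME
(`EdixhovenManinNonPotOrdinary` = `edixhoven_not_dvd_maninConstant_of_not_potentiallyGoodOrdinary`,
`EdixhovenManinKodairaType` = `edixhoven_not_dvd_maninConstant_of_kodairaSymbol_ne`) and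
`PublishedInputsAdditiveKoly` (only Modularity `hnf` and Hoffstein–Luo `hHL` are used): at every
additive `p ≥ 11` with `E[p]` irreducible and `r_an = 1`, for a curve `W` whose WHOLE `ℚ`-isogeny
class lies off Edixhoven's exception (every globally minimal `W' ∼ W`: `¬ TypeGOrd W' p ∨
4 < ord_p Δ_min(W')`), the frame of `ManinGoodOddFrameAdditive` exists: a Hoffstein–Luo field `K`,
a parametrisation datum `Dt` of `W` at level `N` with `p ∤ c(Dt)`, its Heegner point `P ∈ E(K)`,
and a minimal model of the twist `E^{(d_K)}`.

PROOF = `X11b.exists_oddHeegnerData` / `X11b.exists_modularParametrizationData_not_dvd`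
(Jetchev–Skinner–Wan 2017 §7.4.1) with Mazur 1978 Cor. 4.1 replaced by Edixhoven 1991 Thm. 3 AT THE
STRONG CURVE: the `X₀(N)`-optimal curve `W₀ ∼ W` with its lattice-optimal datum `D₀`
(`exists_optimal_modularParametrizationData_of_modularity`, `exists_optimalDatum'`,
`latticeEq_of_modularDegree_le`; level = `N(W₀)` by
`IsNewformOf.level_eq_conductorNorm_of_exists_isNewformOf`), `p ∤ c₀` by
`Addv.not_dvd_maninConstant_of_exception` at `W₀` (the class hypothesis is read at `W₀`; `Addv`
transports by `X2.addv_iff_of_isIsogenous`), a prime-to-`p` integral multiplier `k Λ_{W₀} ⊆ Λ_W`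
(`X11b.exists_int_mul_mem_lattice_not_dvd`, uses `Irr`; the Néron mapping property is the tree
THEOREM `integral_neronScaling_of_isGloballyMinimal_holds`), the datum `(f, Λ_W, k c₀)`
(`ModularParametrizationData.exists_of_isNewformOf`); then the Hoffstein–Luo field
(`exists_admissibleField_of_rootNumber_eq_neg_one`, sign `−1` from `r_an = 1` by `hnf`) and Darmon's
Thm. 3.6 point (`heegnerPointComplex_mem_range_map_holds`) exactly as in `X11b.exists_oddHeegnerData`.

WHY THE CLASS QUANTIFIER (planner rev 5, this seat's flag 2026-08-27T06:11Z): Edixhoven's hypotheses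
are about `W₀`; `¬ TypeGOrd` and `ord_p Δ_min = 6` (I₀*) transport from `W` to `W₀` inside the tree
(`strongException_of_not_typeGOrd`, `strongException_of_eq_six` below, whence the `W`-level rows
`frame_of_not_typeGOrd`, `frame_of_padicValInt_eq_six`), but `4 < ord_p Δ_min` does not: on a
(G)-class the exponent moves at most `v ↦ 12 − v`
(`padicValInt_minimalDiscriminantInt_eq_or_add_eq_twelve_of_isIsogenous_of_typeG`); in print the swap
is excluded under `Irr` by Dokchitser–Dokchitser 2015 Thm. 5.1 (1) (filed separately as a Literature
named fact; not used here).

References: [EdixhovenManin1991] Thm. 3; [JetchevSkinnerWan2017] §7.4.1, Remark 43;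
[HoffsteinLuo1997] Theorem (§1); [Darmon2004] Thm. 3.6; [SilvermanATAEC1994] IV.5.1, Table 4.1;
[SilvermanAEC2009] III.4.11, VI.4.1.
-/

set_option autoImplicit false
-- the Theorems directory repeats the summit name (sibling precedent `SignedBaseChangeAssembly.lean`)
set_option linter.dupNamespace false

noncomputable section

open scoped Classical

open WeierstrassCurve NumberField Literature.NumberTheory.EllipticCurves
  Literature.NumberTheory.EllipticCurves.ModularForms
  Literature.NumberTheory.EllipticCurves.Rank1Residual Literature.NumberTheory.Automorphic
  Summit.BirchSwinnertonDyer.Rank1Residual Summit.BirchSwinnertonDyer.Rank1Residual.Additive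

namespace Summit.BirchSwinnertonDyer.BirchSwinnertonDyer.Theorems.ManinFrameOffExceptionClass

/-! ### §1 Edixhoven at the strong curve (level as a free index) -/

section Strong

variable {W₀ : WeierstrassCurve ℚ} [W₀.IsElliptic] [W₀.IsGloballyMinimal] {p : ℕ} [hp : Fact p.Prime]

/-- **`p ∤ c₀` for a lattice-optimal datum of the strong curve off Edixhoven's exception**
(`Addv.not_dvd_maninConstant_of_exception` with the level a free index `N₀ = N(W₀)`, the
bookkeeping of `KimConjectureIsogenyEdixhoven.not_dvd_maninConstant_isogenous_optimal_of_not_exception`):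
`W₀/ℚ` globally minimal, additive at `p > 7`, `D₀` a datum at level `N(W₀)` with `Λ_{W₀} = c₀ Λ_f`,
and `¬ TypeGOrd W₀ p ∨ 4 < ord_p Δ_min(W₀)` ⟹ `p ∤ c₀`. [cite: EdixhovenManin1991, Thm. 3] -/
theorem not_dvd_c_of_optimal_of_strongException
    (hEdx : edixhoven_not_dvd_maninConstant_of_not_potentiallyGoodOrdinary)
    (hEdxK : edixhoven_not_dvd_maninConstant_of_kodairaSymbol_ne)
    {N₀ : ℕ} [NeZero N₀] (D₀ : ModularParametrizationData W₀ N₀) (hN₀ : W₀.conductorNorm ℤ = N₀)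
    (hopt₀ : ∀ z ∈ D₀.L.lattice, ∃ w ∈ periodLattice D₀.f, z = D₀.c * w) (hp7 : 7 < p)
    (hadd₀ : Addv W₀ p)
    (hexc₀ : ¬ TypeGOrd W₀ p ∨ 4 < padicValInt p W₀.minimalDiscriminantInt) :
    ¬ (p : ℤ) ∣ D₀.c := by
  subst hN₀
  exact Addv.not_dvd_maninConstant_of_exception W₀ p hEdx hEdxK D₀ hopt₀ hp7 hadd₀ hexc₀

end Strong

/-! ### §2 Transport of the exception bit `W → W₀` (the two unconditional rows) -/

section Transport

variable {W W₀ : WeierstrassCurve ℚ} [W.IsElliptic] [W.IsGloballyMinimal] [W₀.IsElliptic]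
  [W₀.IsGloballyMinimal] {p : ℕ} [hp : Fact p.Prime]

/-- **`¬ TypeGOrd` transports to every member**: (G)-ordinarity is a `ℚ`-isogeny invariant on
the additive locus at odd `p` (`typeGOrd_iff_of_isIsogenous`). [cite: SilvermanAEC2009, Cor. VII.7.2] -/
theorem strongException_of_not_typeGOrd (hp2 : p ≠ 2) (hadd : Addv W p) (hiso : IsIsogenous W W₀)
    (hG : ¬ TypeGOrd W p) :
    ¬ TypeGOrd W₀ p ∨ 4 < padicValInt p W₀.minimalDiscriminantInt :=
  Or.inl fun hG₀ ↦ hG ((typeGOrd_iff_of_isIsogenous hp2 hadd hiso).mpr hG₀)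

/-- **Kodaira type I₀* (`ord_p Δ_min = 6`) transports to every member**: on a (G)-class at
`p ≥ 5` the exponent moves at most `v ↦ 12 − v`, and `12 − 6 = 6 > 4`
(`padicValInt_minimalDiscriminantInt_eq_or_add_eq_twelve_of_isIsogenous_of_typeG`); off (G)-ord the
first disjunct transports. [cite: SilvermanATAEC1994, IV Table 4.1 (PDF p. 365)] -/
theorem strongException_of_eq_six (hp5 : 5 ≤ p) (hadd : Addv W p) (hiso : IsIsogenous W W₀)
    (hv : padicValInt p W.minimalDiscriminantInt = 6) :
    ¬ TypeGOrd W₀ p ∨ 4 < padicValInt p W₀.minimalDiscriminantInt := by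
  by_cases hG : TypeGOrd W p
  · right
    rcases padicValInt_minimalDiscriminantInt_eq_or_add_eq_twelve_of_isIsogenous_of_typeG hp5 hadd
      hG.typeG hiso with h | h <;> omega
  · exact strongException_of_not_typeGOrd (by omega) hadd hiso hG

end Transport

/-! ### §3 A datum of `W` at level `N` with `p ∤ c`, for a class off the exception -/

/-- **A datum of `E` at level `N` with Manin constant prime to `p` at an additive `p ≥ 11`**
(the Edixhoven twin of `X11b.exists_modularParametrizationData_not_dvd`): `W/ℚ` globally minimal
of conductor `N`, `p > 7` additive with `E[p]` irreducible, every globally minimal `W₀ ∼ W` off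
Edixhoven's exception (`hexcT`). Inputs: Modularity `hnf` (optimal curve and its minimal-degree
datum `D₀`, lattice-optimal; level = `N(W₀)`), Edixhoven `hEdx`/`hEdxK` (`p ∤ c₀`), the Néron
mapping property (tree theorem `integral_neronScaling_of_isGloballyMinimal_holds`, through
`X11b.exists_int_mul_mem_lattice_not_dvd`: `k Λ_{W₀} ⊆ Λ_W`, `p ∤ k`); the datum is `(f, Λ_W, k c₀)`.
[cite: EdixhovenManin1991, Thm. 3] [cite: JetchevSkinnerWan2017, §7.4.1 (p. 30) and Remark 43]
[cite: AgasheRibetStein2006, Thm. 2.6 and §2] -/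
theorem exists_modularParametrizationData_not_dvd_of_strongException (hnf : exists_isNewformOf)
    (hEdx : edixhoven_not_dvd_maninConstant_of_not_potentiallyGoodOrdinary)
    (hEdxK : edixhoven_not_dvd_maninConstant_of_kodairaSymbol_ne)
    (W : WeierstrassCurve ℚ) [W.IsElliptic] [W.IsGloballyMinimal] {N : ℕ} [NeZero N]
    (hN : W.conductorNorm ℤ = N) (p : ℕ) [hp : Fact p.Prime] (hp7 : 7 < p) (hadd : Addv W p)
    (hirr : Irr W p)
    (hexcT : ∀ (W₀ : WeierstrassCurve ℚ) [W₀.IsElliptic] [W₀.IsGloballyMinimal], IsIsogenous W W₀ →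
      (¬ TypeGOrd W₀ p ∨ 4 < padicValInt p W₀.minimalDiscriminantInt)) :
    ∃ Dt : ModularParametrizationData W N, ¬ (p : ℤ) ∣ Dt.c := by
  haveI : (W.baseChange ℂ).IsElliptic := by rw [WeierstrassCurve.baseChange]; infer_instance
  -- the optimal curve `W₀ ~ W` of the class, with its datum `D₀` of minimal degree
  obtain ⟨W₀, hW₀, hW₀min, D₀, hfW, hisoW, hmin⟩ :=
    exists_optimal_modularParametrizationData_of_modularity hnf N W hN
  haveI := hW₀
  haveI := hW₀min
  -- minimal degree forces lattice-optimality `Λ_{W₀} = c₀ Λ_f`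
  obtain ⟨W₁, hW₁, D₁, hf₁, h₁⟩ := D₀.exists_optimalDatum'
  haveI := hW₁
  have hopt : ∀ z ∈ D₀.L.lattice, ∃ w ∈ periodLattice D₀.f, z = D₀.c * w :=
    D₀.latticeEq_of_modularDegree_le D₁ hf₁ h₁ (hmin W₁ D₁ hf₁)
  -- the level is the conductor of `W₀` (strong multiplicity one, from Modularity)
  have hN₀ : W₀.conductorNorm ℤ = N :=
    (IsNewformOf.level_eq_conductorNorm_of_exists_isNewformOf hnf D₀.isNewformOf).symm
  -- Edixhoven 1991 Thm. 3 at the strong curve: `p ∤ c₀`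
  have hadd₀ : Addv W₀ p := (X2.addv_iff_of_isIsogenous (p := p) hisoW).mp hadd
  have hc₀ : ¬ (p : ℤ) ∣ D₀.c :=
    not_dvd_c_of_optimal_of_strongException hEdx hEdxK D₀ hN₀ hopt hp7 hadd₀ (hexcT W₀ hisoW)
  -- an integral multiplier `k : Λ_{W₀} → Λ_W` prime to `p` (Néron mapping property, a theorem)
  obtain ⟨LW, hLW⟩ := exists_isNeronLatticeOf_holds (W.baseChange ℂ)
  obtain ⟨k, hk0, hpk, hk⟩ :=
    X11b.exists_int_mul_mem_lattice_not_dvd integral_neronScaling_of_isGloballyMinimal_holds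
      hisoW.symm_of_charZero D₀.isNeronLattice hLW hp.out hirr
  -- the datum `(f, Λ_W, k c₀)` of `W`
  have hm0 : k * D₀.c ≠ 0 := mul_ne_zero hk0 D₀.maninConstant_ne_zero_holds
  have hle : ∀ z ∈ periodLattice D₀.f, ((k * D₀.c : ℤ) : ℂ) * z ∈ LW.lattice := fun z hz ↦ by
    have h2 := hk _ (D₀.smul_periodLattice_le z hz)
    rwa [← mul_assoc, ← Int.cast_mul] at h2
  obtain ⟨D, -, -, hDc⟩ := ModularParametrizationData.exists_of_isNewformOf hfW hLW hm0 hle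
  refine ⟨D, fun hdvd ↦ ?_⟩
  rw [hDc] at hdvd
  rcases (Nat.prime_iff_prime_int.mp hp.out).dvd_or_dvd hdvd with h | h
  · exact hpk h
  · exact hc₀ h

/-! ### §4 The Manin-unit Heegner datum and the odd Heegner frame -/

/-- **The Manin-unit Heegner datum at an additive `p ≥ 11` for a class off the exception**
(`X11b.exists_maninDatum_of_odd` with Mazur replaced by Edixhoven at the strong curve): a datum `Dt`
at level `N` with `p ∤ c`, a Heegner datum `H` of discriminant `d_K`, an embedding `ι`, and
`P ∈ E(K)` mapping to the complex Heegner point (Darmon 2004 Thm. 3.6, tree theorem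
`heegnerPointComplex_mem_range_map_holds`). [cite: EdixhovenManin1991, Thm. 3]
[cite: Darmon2004, Thm. 3.6–3.7 (PDF pp. 43–44)] -/
theorem exists_maninDatum_of_strongException (hnf : exists_isNewformOf)
    (hEdx : edixhoven_not_dvd_maninConstant_of_not_potentiallyGoodOrdinary)
    (hEdxK : edixhoven_not_dvd_maninConstant_of_kodairaSymbol_ne)
    (W : WeierstrassCurve ℚ) [W.IsElliptic] [W.IsGloballyMinimal] (p : ℕ) [hp : Fact p.Prime]
    (N : ℕ) [NeZero N] (K : Type) [Field K] [NumberField K] (hN : W.conductorNorm ℤ = N)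
    (hp7 : 7 < p) (hadd : Addv W p) (hirr : Irr W p)
    (hexcT : ∀ (W₀ : WeierstrassCurve ℚ) [W₀.IsElliptic] [W₀.IsGloballyMinimal], IsIsogenous W W₀ →
      (¬ TypeGOrd W₀ p ∨ 4 < padicValInt p W₀.minimalDiscriminantInt))
    (hK : IsImaginaryQuadratic K) (hH : SatisfiesHeegnerHypothesis N K) :
    ∃ (Dt : ModularParametrizationData W N) (H : HeegnerDatum N (NumberField.discr K))
      (ι : K →+* ℂ) (P : (W.baseChange K).toAffine.Point),
      WeierstrassCurve.Affine.Point.map ι.toRatAlgHom P = heegnerPointComplex Dt H ∧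
        ¬ (p : ℤ) ∣ Dt.c := by
  obtain ⟨Dt, hDt⟩ := exists_modularParametrizationData_not_dvd_of_strongException hnf hEdx hEdxK
    W hN p hp7 hadd hirr hexcT
  obtain ⟨β, hβ⟩ := exists_dvd_sq_sub_discr_holds N K hK hH
  obtain ⟨H, -⟩ := nonempty_heegnerDatum_holds N K hK hβ
  obtain ⟨ι⟩ : Nonempty (K →+* ℂ) := inferInstance
  obtain ⟨P, hP⟩ := heegnerPointComplex_mem_range_map_holds N W K hK hH Dt H ι
  exact ⟨Dt, H, ι, P, hP, hDt⟩

/-- **The odd Heegner frame at an additive prime `p ≥ 11` for a class off the exception** — the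
conclusion of `ManinGoodOddFrameAdditive` (shape of `X11b.exists_oddHeegnerData` without `Mult`):
for `W/ℚ` globally minimal with `r_an = 1`, `p > 7` additive, `E[p]` irreducible, every minimal
`W₀ ∼ W` off Edixhoven's exception: a Hoffstein–Luo field `K` (`d_K` odd, `d_K < −4` so `w_K = 2`,
every `ℓ ∣ N` and `p` split so `p ∤ d_K`, `L(E^{(d_K)},1) ≠ 0`;
`exists_admissibleField_of_rootNumber_eq_neg_one` from `hHL` + sign `−1` by `hnf`), the Manin-unit
datum (`exists_maninDatum_of_strongException`), and a globally minimal model of the twist.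
[cite: HoffsteinLuo1997, Theorem (§1, pp. 435–436)] [cite: EdixhovenManin1991, Thm. 3]
[cite: Darmon2004, Thm. 3.6] -/
theorem exists_oddHeegnerFrame_of_strongException (hnf : exists_isNewformOf)
    (hHL : HoffsteinLuo1997_exists_twist_L_one_ne_zero)
    (hEdx : edixhoven_not_dvd_maninConstant_of_not_potentiallyGoodOrdinary)
    (hEdxK : edixhoven_not_dvd_maninConstant_of_kodairaSymbol_ne)
    (W : WeierstrassCurve ℚ) [W.IsElliptic] [W.IsGloballyMinimal] (p : ℕ) [hp : Fact p.Prime]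
    [NeZero (W.conductorNorm ℤ)]
    (hr : W.analyticRank = 1) (hp7 : 7 < p) (hadd : Addv W p) (hirr : Irr W p)
    (hexcT : ∀ (W₀ : WeierstrassCurve ℚ) [W₀.IsElliptic] [W₀.IsGloballyMinimal], IsIsogenous W W₀ →
      (¬ TypeGOrd W₀ p ∨ 4 < padicValInt p W₀.minimalDiscriminantInt)) :
    ∃ (K : Type) (_ : Field K) (_ : NumberField K)
      (Dt : ModularParametrizationData W (W.conductorNorm ℤ))
      (H : HeegnerDatum (W.conductorNorm ℤ) (NumberField.discr K)) (ι : K →+* ℂ)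
      (P : (W.baseChange K).toAffine.Point)
      (Wd : WeierstrassCurve ℚ) (_ : Wd.IsElliptic) (_ : Wd.IsGloballyMinimal) (Cd : VariableChange ℚ),
      IsImaginaryQuadratic K ∧ Odd (NumberField.discr K) ∧ ¬ (p : ℤ) ∣ NumberField.discr K ∧
        SatisfiesHeegnerHypothesis (W.conductorNorm ℤ) K ∧
        WeierstrassCurve.Affine.Point.map ι.toRatAlgHom P = heegnerPointComplex Dt H ∧
        ¬ (p : ℤ) ∣ Dt.c ∧ ¬ p ∣ Units.torsionOrder K ∧
        (W.quadraticTwist (NumberField.discr K : ℚ)).entireLFunction 1 ≠ 0 ∧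
        Cd • W.quadraticTwist (NumberField.discr K : ℚ) = Wd := by
  have hpP : p.Prime := hp.out
  have hp2 : p ≠ 2 := by omega
  -- the sign of the functional equation is `−1` (modularity, `r_an = 1`)
  have hw : W.rootNumber = -1 := by
    rw [WeierstrassCurve.rootNumber_eq_neg_one_pow_analyticRank_of_exists_isNewformOf hnf W, hr]
    norm_num
  -- the Hoffstein–Luo field: `d_K ≡ 1 (mod 8)`, `d_K < −4`, every `ℓ ∣ N` and `p` split
  obtain ⟨K, _, _, hK, hodd, hlt, hHN, hHp, hLt⟩ :=
    exists_admissibleField_of_rootNumber_eq_neg_one hnf hHL W hw p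
  have hpd : ¬ (p : ℤ) ∣ NumberField.discr K := not_dvd_discr_of_split hK hpP hp2 hHp
  -- `w_K = 2`, prime to the odd prime `p`
  have hμ : ¬ p ∣ Units.torsionOrder K := by
    haveI : IsTotallyComplex K := hK.2
    rw [Literature.NumberTheory.DiophantineGeometry.torsionOrder_eq_two_of_discr_lt hK.1 hlt]
    intro h2
    have := Nat.le_of_dvd two_pos h2
    omega
  -- the Heegner datum with `p ∤ c`
  obtain ⟨Dt, H, ι, P, hP, hc⟩ := exists_maninDatum_of_strongException hnf hEdx hEdxK W p
    (W.conductorNorm ℤ) K rfl hp7 hadd hirr hexcT hK hHN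
  -- a globally minimal model of the twist
  have hD0 : (NumberField.discr K : ℚ) ≠ 0 := by exact_mod_cast NumberField.discr_ne_zero K
  haveI hEt : (W.quadraticTwist (NumberField.discr K : ℚ)).IsElliptic :=
    W.isElliptic_quadraticTwist hD0
  obtain ⟨Cd, hCd⟩ := hasGlobalMinimalModel_rat_holds (W.quadraticTwist (NumberField.discr K : ℚ))
  exact ⟨K, inferInstance, inferInstance, Dt, H, ι, P, Cd • W.quadraticTwist (NumberField.discr K : ℚ),
    inferInstance, hCd, Cd, hK, hodd, hpd, hHN, hP, hc, hμ, hLt, rfl⟩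

/-! ### §5 The item, and its two `W`-level rows -/

open Summit.BirchSwinnertonDyer.BirchSwinnertonDyer.Theses.AdditiveKolyvaginRoad in
/-- **`ManinFrameOffExceptionClass` (item stmt-BirchSwinnertonDyer-20092) — the route decl BY
NAME, unconditional**: `hEdx`, `hEdxK` are the decl's first two hypotheses, `hnf`, `hHL` are
conjuncts 6 and 7 of `PublishedInputsAdditiveKoly`, and the class hypothesis is `hexcT` of
`exists_oddHeegnerFrame_of_strongException`. [cite: EdixhovenManin1991, Thm. 3]
[cite: HoffsteinLuo1997, Theorem (§1)] [cite: Darmon2004, Thm. 3.6] -/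
theorem maninFrameOffExceptionClass_proof : ManinFrameOffExceptionClass := by
  intro hEdx hEdxK hPub W _ _ p _ _ hp11 hadd hirr hexcT hr
  exact exists_oddHeegnerFrame_of_strongException hPub.2.2.2.2.2.1 hPub.2.2.2.2.2.2.1 hEdx hEdxK W p
    hr (by omega) hadd hirr (fun W₀ _ _ hiso ↦ hexcT W₀ hiso)

open Summit.BirchSwinnertonDyer.BirchSwinnertonDyer.Theses.AdditiveKolyvaginRoad in
/-- **The `¬ TypeGOrd W p` row, read on `W` alone** (potentially multiplicative, potentially
supersingular and (T′) pairs at `p ≥ 11`): the class hypothesis of `ManinFrameOffExceptionClass` is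
discharged by `strongException_of_not_typeGOrd`. [cite: EdixhovenManin1991, Thm. 3]
[cite: HoffsteinLuo1997, Theorem (§1)] [cite: Darmon2004, Thm. 3.6] -/
theorem frame_of_not_typeGOrd (hEdx : EdixhovenManinNonPotOrdinary) (hEdxK : EdixhovenManinKodairaType)
    (hPub : PublishedInputsAdditiveKoly)
    (W : WeierstrassCurve ℚ) [W.IsElliptic] [W.IsGloballyMinimal] (p : ℕ) [Fact p.Prime]
    [NeZero (W.conductorNorm ℤ)] (hp11 : 11 ≤ p) (hadd : Addv W p) (hirr : Irr W p)
    (hG : ¬ TypeGOrd W p) (hr : W.analyticRank = 1) :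
    ∃ (K : Type) (_ : Field K) (_ : NumberField K)
      (Dt : ModularParametrizationData W (W.conductorNorm ℤ))
      (H : HeegnerDatum (W.conductorNorm ℤ) (NumberField.discr K)) (ι : K →+* ℂ)
      (P : (W.baseChange K).toAffine.Point)
      (Wd : WeierstrassCurve ℚ) (_ : Wd.IsElliptic) (_ : Wd.IsGloballyMinimal) (Cd : VariableChange ℚ),
      IsImaginaryQuadratic K ∧ Odd (NumberField.discr K) ∧ ¬ (p : ℤ) ∣ NumberField.discr K ∧
        SatisfiesHeegnerHypothesis (W.conductorNorm ℤ) K ∧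
        WeierstrassCurve.Affine.Point.map ι.toRatAlgHom P = heegnerPointComplex Dt H ∧
        ¬ (p : ℤ) ∣ Dt.c ∧ ¬ p ∣ Units.torsionOrder K ∧
        (W.quadraticTwist (NumberField.discr K : ℚ)).entireLFunction 1 ≠ 0 ∧
        Cd • W.quadraticTwist (NumberField.discr K : ℚ) = Wd :=
  maninFrameOffExceptionClass_proof hEdx hEdxK hPub W p hp11 hadd hirr
    (fun _ _ _ hiso ↦ strongException_of_not_typeGOrd (by omega) hadd hiso hG) hr

open Summit.BirchSwinnertonDyer.BirchSwinnertonDyer.Theses.AdditiveKolyvaginRoad in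
/-- **The I₀* row (`ord_p Δ_min(W) = 6`), read on `W` alone**: the class hypothesis of
`ManinFrameOffExceptionClass` is discharged by `strongException_of_eq_six` (`v = 6` is rigid on the
class). [cite: EdixhovenManin1991, Thm. 3] [cite: SilvermanATAEC1994, IV Table 4.1 (PDF p. 365)]
[cite: Darmon2004, Thm. 3.6] -/
theorem frame_of_padicValInt_eq_six (hEdx : EdixhovenManinNonPotOrdinary)
    (hEdxK : EdixhovenManinKodairaType) (hPub : PublishedInputsAdditiveKoly)
    (W : WeierstrassCurve ℚ) [W.IsElliptic] [W.IsGloballyMinimal] (p : ℕ) [Fact p.Prime]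
    [NeZero (W.conductorNorm ℤ)] (hp11 : 11 ≤ p) (hadd : Addv W p) (hirr : Irr W p)
    (hv : padicValInt p W.minimalDiscriminantInt = 6) (hr : W.analyticRank = 1) :
    ∃ (K : Type) (_ : Field K) (_ : NumberField K)
      (Dt : ModularParametrizationData W (W.conductorNorm ℤ))
      (H : HeegnerDatum (W.conductorNorm ℤ) (NumberField.discr K)) (ι : K →+* ℂ)
      (P : (W.baseChange K).toAffine.Point)
      (Wd : WeierstrassCurve ℚ) (_ : Wd.IsElliptic) (_ : Wd.IsGloballyMinimal) (Cd : VariableChange ℚ),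
      IsImaginaryQuadratic K ∧ Odd (NumberField.discr K) ∧ ¬ (p : ℤ) ∣ NumberField.discr K ∧
        SatisfiesHeegnerHypothesis (W.conductorNorm ℤ) K ∧
        WeierstrassCurve.Affine.Point.map ι.toRatAlgHom P = heegnerPointComplex Dt H ∧
        ¬ (p : ℤ) ∣ Dt.c ∧ ¬ p ∣ Units.torsionOrder K ∧
        (W.quadraticTwist (NumberField.discr K : ℚ)).entireLFunction 1 ≠ 0 ∧
        Cd • W.quadraticTwist (NumberField.discr K : ℚ) = Wd :=
  maninFrameOffExceptionClass_proof hEdx hEdxK hPub W p hp11 hadd hirr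
    (fun _ _ _ hiso ↦ strongException_of_eq_six (by omega) hadd hiso hv) hr

end Summit.BirchSwinnertonDyer.BirchSwinnertonDyer.Theorems.ManinFrameOffExceptionClass

end
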